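import Mathlib
import Summits.Ventures.PercRepro2.SwOutAll
import Summits.Ventures.PercRepro2.SwOutArmFlip
import Summits.Ventures.PercRepro2.SwOutArms
import Summits.Ventures.PercRepro2.SwOutArmOrbit
import Summits.Ventures.PercRepro2.SwOutArmCube
import Summits.Ventures.PercRepro2.SwOutArmThm
import Summits.Ventures.PercRepro2.SwOutJunctionFine
import Summits.Ventures.PercRepro2.SwOutJunctionRegion
import Summits.Ventures.PercRepro2.SwOutJunction
import Summits.Ventures.PercRepro2.SwOutJunctionsSplit
import Summits.Ventures.PercRepro2.SwOutJunctionsFine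
import Summits.Ventures.PercRepro2.SwOutJunctionsRegion

/-!
# THE MULTI-JUNCTION THEOREM (blind cell PercRepro2, night-4 g11, 2026-08-25;
proofs/NIGHT4-G11.md §5(3))

A region `U ∋ h` (`l ∉ U`, no loop at `h`) with an INDEPENDENT set `J ⊆ U ∖ {h, o}` of junctions,
each with all its neighbours other than `h` adjacent to `h`, every other vertex of `U ∖ {h, o}`
with an outside edge or no edge: every class satisfies the rigid counting inequality of (HLC)
(`rigidOK_of_junctions`).  Proof: a configuration `ζ` is split at exactly the junctions all of
whose edges are MATCHED (`matchedSet`); in that partially split graph `ζ` is core-free (a core at a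
junction is matched, hence split into one-sided leaves), the class and the side `Q` and the rigid
edge sets are seen exactly (`SwOutJunctionsFine`, `SwOutJunctionsRegion`), and the matched set is
constant along the arm orbits (`matchedSet_orbitReal`).  Summing the arm principle `card_orbit_le`
of every partially split graph over the fibres of `ζ ↦ (matchedSet ζ, allRed ζ)` gives the theorem.
The single-junction theorem is the case `J = {u}`.
-/

namespace Summit.Ventures.PercRepro2

namespace LocRows

open Hull

variable {V : Type*} {E : Type*} [Fintype E] [DecidableEq E]

open scoped Classical

variable {ends : E → Sym2 V} {U : Set V} {ξ : Config E} {l h o : V} {J : Set V}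

/-- The junctions of `J` all of whose edges are matched in `ζ`. -/
def matchedSet (ends : E → Sym2 V) (J : Set V) (h : V) (ζ : Config E) : Set V :=
  {u | u ∈ J ∧ Matched ends u h ζ}

omit [Fintype E] [DecidableEq E] in
/-- The matched set lies in `J`. -/
lemma matchedSet_subset (ζ : Config E) : matchedSet ends J h ζ ⊆ J := fun _ hu => hu.1

omit [Fintype E] [DecidableEq E] in
/-- Independence passes to subsets. -/
lemma indepSet_mono {S S' : Set V} (hS : S ⊆ S') (hind : IndepSet ends S') : IndepSet ends S :=
  fun e x hx y hy => hind e x (hS hx) y (hS hy)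

section Core

/-- Every core of a `Q`-configuration is `h` or a junction. -/
theorem core_mem_J_of_out
    (hout : ∀ x ∈ U, x ≠ h → x ≠ o → x ∉ J →
      (∃ e y, ends e = s(x, y) ∧ y ∉ U) ∨ (∀ e, x ∉ ends e))
    {ζ : Config E} (hζ : ζ ∈ swOutSide ends l h o U ξ) {x : V} (hxT : x ∈ cluster ends ζ h)
    (hxTp : x ∈ cluster ends (blue ζ) h) : x = h ∨ x ∈ J := by
  by_cases hxh : x = h
  · exact Or.inl hxh
  by_cases hxJ : x ∈ J
  · exact Or.inr hxJ
  exfalso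
  have hQ := (mem_swOutSide.1 hζ).1
  have hcl := (mem_swOutSide.1 hζ).2
  rw [mem_tgtU_iff'] at hQ
  obtain ⟨hhl, hoA, _⟩ := hQ
  have hhA : h ∉ cluster ends ζ l := fun h' => hhl (Or.inl h')
  have hxU : x ∈ U := (mem_outClass.1 hcl).2 (Or.inl hxT)
  by_cases hxo : x = o
  · subst hxo
    exact hhA (conn_trans hoA (conn_symm hxT))
  · rcases hout x hxU hxh hxo hxJ with ⟨e, y, hxy, hyU⟩ | hiso
    · cases he : ζ e with
      | true => exact hyU ((mem_outClass.1 hcl).2 (Or.inl (mem_cluster_of_edge hxT he hxy)))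
      | false =>
        have he' : blue ζ e = true := by rw [blue_eq_true_iff]; exact he
        exact hyU ((mem_outClass.1 hcl).2 (Or.inr (mem_cluster_of_edge hxTp he' hxy)))
    · obtain ⟨e, hxe⟩ := exists_edge_of_mem_cluster hxT hxh
      exact hiso e hxe

/-- Every core of a `Q`-configuration is `h` or a MATCHED junction. -/
theorem core_mem_matchedSet
    (hout : ∀ x ∈ U, x ≠ h → x ≠ o → x ∉ J →
      (∃ e y, ends e = s(x, y) ∧ y ∉ U) ∨ (∀ e, x ∉ ends e))
    {ζ : Config E} (hζ : ζ ∈ swOutSide ends l h o U ξ) {x : V} (hxT : x ∈ cluster ends ζ h)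
    (hxTp : x ∈ cluster ends (blue ζ) h) : x = h ∨ x ∈ matchedSet ends J h ζ := by
  rcases core_mem_J_of_out hout hζ hxT hxTp with h1 | h1
  · exact Or.inl h1
  · exact Or.inr ⟨h1, matched_of_core hxT hxTp⟩

/-- A `Q`-configuration is fine for its matched set. -/
theorem mfine_matchedSet (hhJ : h ∉ J) (hind : IndepSet ends J)
    (hadj : ∀ u ∈ J, ∀ e (he : u ∈ ends e), Sym2.Mem.other he ≠ h →
      ∃ e', ends e' = s(Sym2.Mem.other he, h))
    (hout : ∀ x ∈ U, x ≠ h → x ≠ o → x ∉ J →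
      (∃ e y, ends e = s(x, y) ∧ y ∉ U) ∨ (∀ e, x ∉ ends e))
    {ζ : Config E} (hζ : ζ ∈ swOutSide ends l h o U ξ) :
    MFine ends (matchedSet ends J h ζ) h ζ :=
  mfine_of_matched (indepSet_mono (matchedSet_subset (ends := ends) (h := h) ζ) hind)
    (fun h' => hhJ h'.1) (fun u hu => hadj u hu.1)
    (fun _ hx hx' => core_mem_matchedSet hout hζ hx hx') (fun _ hu => hu.2)

/-- A `Q`-configuration is core-free in the graph split at its matched set. -/
theorem coreFree_split_matchedSet (hhJ : h ∉ J) (hind : IndepSet ends J)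
    (hout : ∀ x ∈ U, x ≠ h → x ≠ o → x ∉ J →
      (∃ e y, ends e = s(x, y) ∧ y ∉ U) ∨ (∀ e, x ∉ ends e))
    {ζ : Config E} (hζ : ζ ∈ swOutSide ends l h o U ξ) :
    CoreFree (splitEndsS ends (matchedSet ends J h ζ)) ζ (Sum.inl h) := by
  have hind' : IndepSet ends (matchedSet ends J h ζ) :=
    indepSet_mono (matchedSet_subset (ends := ends) (h := h) ζ) hind
  rintro (x | e) hxT hxTp
  · have h1 : x ∈ cluster ends ζ h := conn_of_conn_splitS_inl hind' hxT
    have h2 : x ∈ cluster ends (blue ζ) h := conn_of_conn_splitS_inl hind' hxTp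
    rcases core_mem_matchedSet hout hζ h1 h2 with rfl | hxM
    · rfl
    · exact absurd hxT (inl_S_notMem_cluster_splitS hxM (fun h' => hhJ (h' ▸ hxM.1)))
  · exfalso
    obtain ⟨_, _, _, h1, _⟩ := conn_of_conn_splitS_inr hind' hxT
    obtain ⟨_, _, _, h2, _⟩ := conn_of_conn_splitS_inr hind' hxTp
    rw [blue_eq_true_iff] at h2
    rw [h1] at h2
    exact absurd h2 (by simp)

end Core

/-! ## Matchedness at an unsplit junction, seen through the split -/

section Unsplit

variable {S : Set V}

omit [Fintype E] [DecidableEq E] in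
/-- For `u ∉ S` with no neighbour in `S` and no loop, and an `S`-fine configuration, `u` is
matched in the graph iff `inl u` is matched in the split graph. -/
theorem matched_iff_matched_splitS (hind : IndepSet ends S) (hhS : h ∉ S) {u : V} (huS : u ∉ S)
    (hunb : ∀ e p, ends e = s(u, p) → p ∉ S ∧ p ≠ u) {η : Config E} (hf : MFine ends S h η) :
    Matched ends u h η ↔ Matched (splitEndsS ends S) (Sum.inl u) (Sum.inl h) η := by
  constructor
  · intro hm e he' hph'
    -- `e` is an edge at `u` in the graph
    obtain ⟨hue, _⟩ := inl_mem_splitEndsS_iff.1 he'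
    have hends := ends_eq_otherS hue
    obtain ⟨hpS, hpu⟩ := hunb e _ hends
    have hsplit : splitEndsS ends S e = s(Sum.inl u, Sum.inl (Sym2.Mem.other hue)) :=
      splitEndsS_of_notMem hends huS hpS
    have hoth : Sym2.Mem.other he' = Sum.inl (Sym2.Mem.other hue) :=
      other_eq_of_endsS he' hsplit (fun h' => hpu (Sum.inl.inj h'))
    rw [hoth] at hph' ⊢
    have hph : Sym2.Mem.other hue ≠ h := fun h' => hph' (by rw [h'])
    obtain ⟨h1, h2⟩ := hm e hue hph
    constructor
    · intro hc
      exact (inl_mem_cluster_splitS_iff_of_mfine hind hhS hf hpS).2 (h1 hc)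
    · intro hc
      exact (inl_mem_cluster_splitS_iff_of_mfine hind hhS (mfine_blue_iff.2 hf) hpS).2 (h2 hc)
  · intro hm e hue hph
    have hends := ends_eq_otherS hue
    obtain ⟨hpS, hpu⟩ := hunb e _ hends
    have hsplit : splitEndsS ends S e = s(Sum.inl u, Sum.inl (Sym2.Mem.other hue)) :=
      splitEndsS_of_notMem hends huS hpS
    have he' : Sum.inl u ∈ splitEndsS ends S e := by rw [hsplit]; exact Sym2.mem_mk_left _ _
    have hoth : Sym2.Mem.other he' = Sum.inl (Sym2.Mem.other hue) :=
      other_eq_of_endsS he' hsplit (fun h' => hpu (Sum.inl.inj h'))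
    have hph' : Sym2.Mem.other he' ≠ Sum.inl h := by rw [hoth]; exact fun h' => hph (Sum.inl.inj h')
    obtain ⟨h1, h2⟩ := hm e he' hph'
    rw [hoth] at h1 h2
    constructor
    · intro hc
      exact conn_of_conn_splitS_inl hind (h1 hc)
    · intro hc
      exact conn_of_conn_splitS_inl hind (h2 hc)

end Unsplit

/-! ## The matched set is constant along the orbits of the partially split graph -/

section Orbit

variable (hl : l ∉ U) (hhJ : h ∉ J) (hJU : J ⊆ U) (hind : IndepSet ends J)
  (hadj : ∀ u ∈ J, ∀ e (he : u ∈ ends e), Sym2.Mem.other he ≠ h →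
    ∃ e', ends e' = s(Sym2.Mem.other he, h))
  (hout : ∀ x ∈ U, x ≠ h → x ≠ o → x ∉ J →
    (∃ e y, ends e = s(x, y) ∧ y ∉ U) ∨ (∀ e, x ∉ ends e))

include hhJ hind hadj hout in
/-- A junction outside the matched set of `ζ₁` is unmatched in every configuration obtained
from `ζ₁` by arm flips of the graph split at that matched set (and fine for it). -/
lemma not_matched_of_flips {ζ₁ : Config E} (hζ₁ : ζ₁ ∈ swOutSide ends l h o U ξ) {u : V}
    (huJ : u ∈ J) (huM : u ∉ matchedSet ends J h ζ₁) {η : Config E}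
    (hf : MFine ends (matchedSet ends J h ζ₁) h η)
    (hm : Matched (splitEndsS ends (matchedSet ends J h ζ₁)) (Sum.inl u) (Sum.inl h) η →
      Matched (splitEndsS ends (matchedSet ends J h ζ₁)) (Sum.inl u) (Sum.inl h) ζ₁) :
    ¬ Matched ends u h η := by
  intro hmη
  have hind' : IndepSet ends (matchedSet ends J h ζ₁) :=
    indepSet_mono (matchedSet_subset (ends := ends) (h := h) ζ₁) hind
  have hhM : h ∉ matchedSet ends J h ζ₁ := fun h' => hhJ h'.1
  have hunb : ∀ e p, ends e = s(u, p) → p ∉ matchedSet ends J h ζ₁ ∧ p ≠ u := by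
    intro e p hep
    constructor
    · intro hpM
      exact hind e u huJ p hpM.1 hep
    · rintro rfl
      exact hind e p huJ p huJ hep
  have hf₁ : MFine ends (matchedSet ends J h ζ₁) h ζ₁ := mfine_matchedSet hhJ hind hadj hout hζ₁
  have h1 := (matched_iff_matched_splitS hind' hhM huM hunb hf).1 hmη
  have h2 := (matched_iff_matched_splitS hind' hhM huM hunb hf₁).2 (hm h1)
  exact huM ⟨huJ, h2⟩

include hhJ hind hadj hout in
/-- **The matched set is constant along the orbit** of the graph split at it. -/
theorem matchedSet_orbitReal {ζ₁ : Config E} (hζ₁ : ζ₁ ∈ swOutSide ends l h o U ξ)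
    (ω : Config (arms (splitEndsS ends (matchedSet ends J h ζ₁))
      (allRed (splitEndsS ends (matchedSet ends J h ζ₁)) ζ₁ (Sum.inl h)) (Sum.inl h))) :
    matchedSet ends J h (orbitReal (splitEndsS ends (matchedSet ends J h ζ₁))
      (allRed (splitEndsS ends (matchedSet ends J h ζ₁)) ζ₁ (Sum.inl h)) (Sum.inl h) ω) =
      matchedSet ends J h ζ₁ := by
  have hind' : IndepSet ends (matchedSet ends J h ζ₁) :=
    indepSet_mono (matchedSet_subset (ends := ends) (h := h) ζ₁) hind
  have hc₁ : CoreFree (splitEndsS ends (matchedSet ends J h ζ₁)) ζ₁ (Sum.inl h) :=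
    coreFree_split_matchedSet hhJ hind hout hζ₁
  have hf₁ : MFine ends (matchedSet ends J h ζ₁) h ζ₁ := mfine_matchedSet hhJ hind hadj hout hζ₁
  have hc₀ : CoreFree (splitEndsS ends (matchedSet ends J h ζ₁))
      (allRed (splitEndsS ends (matchedSet ends J h ζ₁)) ζ₁ (Sum.inl h)) (Sum.inl h) :=
    coreFree_allRed hc₁
  -- the orbit point is fine for the matched set: its split hull is that of `ζ₁`
  have hfη : MFine ends (matchedSet ends J h ζ₁) h (orbitReal (splitEndsS ends (matchedSet ends J h ζ₁))
      (allRed (splitEndsS ends (matchedSet ends J h ζ₁)) ζ₁ (Sum.inl h)) (Sum.inl h) ω) := by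
    intro e he
    rw [hull_orbitReal hc₀, hull_allRed hc₁]
    exact hf₁ e he
  ext u
  constructor
  · rintro ⟨huJ, hmu⟩
    by_contra huM
    refine not_matched_of_flips hhJ hind hadj hout hζ₁ huJ huM hfη (fun hm => ?_) hmu
    -- two arm flips back to `ζ₁`
    have h1 := matched_of_matched_flip (coreFree_allRed hc₀) (armClosed_armsFalse_allRed hc₀ ω) hm
    rw [allRed_idem hc₁] at h1
    exact matched_of_matched_flip hc₁ (armClosed_blueSide hc₁) h1
  · intro huM
    exact ⟨huM.1, matched_of_mfine hind' hfη huM⟩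

end Orbit

/-! ## The multi-junction theorem -/

section Main

variable (hl : l ∉ U) (hloop_h : ∀ e, ends e ≠ s(h, h)) (hJU : J ⊆ U) (hhJ : h ∉ J)
  (hind : IndepSet ends J)
  (hadj : ∀ u ∈ J, ∀ e (he : u ∈ ends e), Sym2.Mem.other he ≠ h →
    ∃ e', ends e' = s(Sym2.Mem.other he, h))
  (hout : ∀ x ∈ U, x ≠ h → x ≠ o → x ∉ J →
    (∃ e y, ends e = s(x, y) ∧ y ∉ U) ∨ (∀ e, x ∉ ends e))

omit [Fintype E] [DecidableEq E] in
/-- The split graph has no loop at `inl h` (`h ∉ S`). -/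
lemma splitEndsS_ne_loop_h (hloop_h : ∀ e, ends e ≠ s(h, h)) {S : Set V} (e : E) :
    splitEndsS ends S e ≠ s(Sum.inl h, Sum.inl h) := by
  intro h'
  have h1 : Sum.inl h ∈ splitEndsS ends S e := by rw [h']; exact Sym2.mem_mk_left _ _
  obtain ⟨hhe, _⟩ := inl_mem_splitEndsS_iff.1 h1
  obtain ⟨p, q, hpq⟩ := exists_pairS (ends e)
  have hp : p ∉ S ∨ q ∉ S := by
    by_contra hcon
    push Not at hcon
    have := inr_mem_splitEndsS_iff (ends := ends) (S := S) (e := e) (e' := e)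
    have h2 : Sum.inr e ∈ splitEndsS ends S e := this.2 ⟨rfl, p, hcon.1, by rw [hpq]; exact Sym2.mem_mk_left _ _⟩
    rw [h'] at h2
    rw [Sym2.mem_iff] at h2
    rcases h2 with h2 | h2 <;> exact absurd h2 Sum.inr_ne_inl
  -- both ends are `inl`: the edge has no end in `S`, so it is `s(h, h)`
  have hpS : p ∉ S := by
    rcases hp with hp | hq
    · exact hp
    · intro hpS
      have h2 : Sum.inr e ∈ splitEndsS ends S e :=
        inr_mem_splitEndsS_iff.2 ⟨rfl, p, hpS, by rw [hpq]; exact Sym2.mem_mk_left _ _⟩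
      rw [h', Sym2.mem_iff] at h2
      rcases h2 with h2 | h2 <;> exact absurd h2 Sum.inr_ne_inl
  have hqS : q ∉ S := by
    intro hqS
    have h2 : Sum.inr e ∈ splitEndsS ends S e :=
      inr_mem_splitEndsS_iff.2 ⟨rfl, q, hqS, by rw [hpq]; exact Sym2.mem_mk_right _ _⟩
    rw [h', Sym2.mem_iff] at h2
    rcases h2 with h2 | h2 <;> exact absurd h2 Sum.inr_ne_inl
  rw [splitEndsS_of_notMem hpq hpS hqS, Sym2.eq_iff] at h'
  rcases h' with ⟨h1, h2⟩ | ⟨h1, h2⟩ <;>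
    exact hloop_h e (by rw [hpq, Sum.inl.inj h1, Sum.inl.inj h2])

omit [Fintype E] [DecidableEq E] in
/-- `inl l` is outside the split region. -/
lemma inl_notMem_splitRegionS (hl : l ∉ U) : Sum.inl l ∉ splitRegionS (V := V) (E := E) U := by
  rintro (⟨x, hx, hxl⟩ | ⟨e, he⟩)
  · exact hl ((Sum.inl.inj hxl) ▸ hx)
  · exact Sum.inr_ne_inl he

include hl hloop_h hJU hhJ hind hadj hout in
/-- **THE MULTI-JUNCTION THEOREM**: the rigid counting inequality of (HLC) on every class of a
region with an independent set `J` of junctions (no loop at `h`, `h ∉ J`, every neighbour `p ≠ h`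
of a junction adjacent to `h`, every vertex of `U ∖ {h, o}` outside `J` with an outside edge or no
edge). -/
theorem rigidOK_of_junctions {𝓔 : Set (Set E)} (h𝓔 : IsUpperSet 𝓔) :
    ((swOutSide ends l h o U ξ).filter fun ζ => redEdges ends ζ h ∈ 𝓔).card ≤
      ((swOutSide ends l h o U ξ).filter fun ζ => blueEdges ends ζ h ∈ 𝓔).card := by
  have hlJ : l ∉ J := fun h' => hl (hJU h')
  let key : Config E → Set V × Config E := fun ζ =>
    (matchedSet ends J h ζ, allRed (splitEndsS ends (matchedSet ends J h ζ)) ζ (Sum.inl h))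
  let S₀ : Finset (Set V × Config E) := (swOutSide ends l h o U ξ).image key
  have hmap : ∀ (P : Config E → Prop) (ζ : Config E),
      ζ ∈ (swOutSide ends l h o U ξ).filter P → key ζ ∈ S₀ :=
    fun P ζ hζ => Finset.mem_image_of_mem key (Finset.mem_filter.1 hζ).1
  rw [Finset.card_eq_sum_card_fiberwise (hmap _), Finset.card_eq_sum_card_fiberwise (hmap _)]
  refine Finset.sum_le_sum fun k hk => ?_
  obtain ⟨ζ₁, hζ₁, rfl⟩ := Finset.mem_image.1 hk
  have hind' : IndepSet ends (matchedSet ends J h ζ₁) :=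
    indepSet_mono (matchedSet_subset (ends := ends) (h := h) ζ₁) hind
  have hMU : matchedSet ends J h ζ₁ ⊆ U := fun u hu => hJU hu.1
  have hhM : h ∉ matchedSet ends J h ζ₁ := fun h' => hhJ h'.1
  have hlM : l ∉ matchedSet ends J h ζ₁ := fun h' => hlJ h'.1
  have hl' := inl_notMem_splitRegionS (V := V) (E := E) (U := U) hl
  have hloop' := splitEndsS_ne_loop_h (ends := ends) (S := matchedSet ends J h ζ₁) hloop_h
  have hc₁ : CoreFree (splitEndsS ends (matchedSet ends J h ζ₁)) ζ₁ (Sum.inl h) :=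
    coreFree_split_matchedSet hhJ hind hout hζ₁
  have hf₁ : MFine ends (matchedSet ends J h ζ₁) h ζ₁ := mfine_matchedSet hhJ hind hadj hout hζ₁
  have hcl₁ : ζ₁ ∈ outClass (splitEndsS ends (matchedSet ends J h ζ₁)) (splitRegionS U) (Sum.inl h) ξ :=
    mem_outClass_splitS_of_mem hind' hMU (mem_swOutSide.1 hζ₁).2
  have hc₀ : CoreFree (splitEndsS ends (matchedSet ends J h ζ₁)) (allRed (splitEndsS ends (matchedSet ends J h ζ₁)) ζ₁ (Sum.inl h)) (Sum.inl h) :=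
    coreFree_allRed hc₁
  have hcl₀ : allRed (splitEndsS ends (matchedSet ends J h ζ₁)) ζ₁ (Sum.inl h) ∈
      outClass (splitEndsS ends (matchedSet ends J h ζ₁)) (splitRegionS U) (Sum.inl h) ξ := allRed_mem_outClass hcl₁ hc₁
  -- the fibre is the orbit of the split graph intersected with its side `Q`
  have hfib : ∀ (P P' : Config E → Prop), (∀ ζ, MFine ends (matchedSet ends J h ζ₁) h ζ → (P ζ ↔ P' ζ)) →
      ((swOutSide ends l h o U ξ).filter P).filter (fun ζ => key ζ = key ζ₁) =
        (orbit (splitEndsS ends (matchedSet ends J h ζ₁)) (allRed (splitEndsS ends (matchedSet ends J h ζ₁)) ζ₁ (Sum.inl h)) (Sum.inl h)).filter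
          fun ζ' => ζ' ∈ tgtU (splitEndsS ends (matchedSet ends J h ζ₁)) (Sum.inl l) (Sum.inl h)
            {T : Set (V ⊕ E) | Sum.inl o ∈ T} ∧ P' ζ' := by
    intro P P' hPP'
    ext ζ'
    simp only [Finset.mem_filter, orbit, Finset.mem_image, Finset.mem_univ, true_and, key,
      Prod.mk.injEq]
    constructor
    · rintro ⟨⟨hζ', hP⟩, hMeq, hred⟩
      rw [hMeq] at hred
      have hf' : MFine ends (matchedSet ends J h ζ₁) h ζ' := by
        rw [← hMeq]; exact mfine_matchedSet hhJ hind hadj hout hζ'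
      have hc' : CoreFree (splitEndsS ends (matchedSet ends J h ζ₁)) ζ' (Sum.inl h) := by
        rw [← hMeq]; exact coreFree_split_matchedSet hhJ hind hout hζ'
      obtain ⟨ω, hω⟩ := exists_orbitReal_eq hc' hred
      exact ⟨⟨ω, hω⟩, mem_tgtU_splitS_of_mem hind' hf' hlM (mem_swOutSide.1 hζ').1,
        (hPP' ζ' hf').1 hP⟩
    · rintro ⟨⟨ω, rfl⟩, hQ', hP'⟩
      have hf' : MFine ends (matchedSet ends J h ζ₁) h (orbitReal (splitEndsS ends (matchedSet ends J h ζ₁))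
          (allRed (splitEndsS ends (matchedSet ends J h ζ₁)) ζ₁ (Sum.inl h)) (Sum.inl h) ω) := by
        intro e he
        rw [hull_orbitReal hc₀, hull_allRed hc₁]
        exact hf₁ e he
      have hcl' := orbitReal_mem_outClass hc₀ hcl₀ ω
      have hMeq := matchedSet_orbitReal hhJ hind hadj hout hζ₁ ω
      refine ⟨⟨mem_swOutSide.2 ⟨mem_tgtU_of_mem_splitS hind' hlM hf' hQ',
        mem_outClass_of_mem_splitS hind' hMU hhM hf' hcl'⟩, (hPP' _ hf').2 hP'⟩, hMeq, ?_⟩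
      rw [hMeq, allRed_orbitReal hc₀ ω, allRed_idem hc₁]
  rw [hfib _ (fun ζ' => redEdges (splitEndsS ends (matchedSet ends J h ζ₁)) ζ' (Sum.inl h) ∈ 𝓔)
      (fun ζ hf => by rw [redEdges_eq_of_mfine hind' hhM hf]),
    hfib _ (fun ζ' => blueEdges (splitEndsS ends (matchedSet ends J h ζ₁)) ζ' (Sum.inl h) ∈ 𝓔)
      (fun ζ hf => by rw [blueEdges_eq_of_mfine hind' hhM hf])]
  exact card_orbit_le hc₀ hloop' hcl₀ hl' h𝓔

end Main

end LocRows

end Summit.Ventures.PercRepro2
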